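import Summits.Langlands.Langlands.Theorems.QuadraticWindowHostInducedRepPackageFamily
import Summits.Langlands.Langlands.Theorems.QuadraticWindowHostInducedRepPaneDefsCont

/-!
# The family assembly in the continuation-form currency — `stub_package_of_member_cont`
# (line `one-transparent-pane`, crux `Summit.Langlands.Langlands.Theses.QuadraticWindow.HostInducedRep`,
# stmt-Langlands-10902; wave 4)

LOG (wave-4 worker C, 2026-08-16): `_cont` variant of the landed `stub_package_of_member`
(`QuadraticWindowHostInducedRepPackageFamily.lean`, p95457): the member hypothesis is `MemberPkgCont`
(`QuadraticWindowHostInducedRepPaneDefsCont.lean`) instead of `MemberPkg`, and the Asai-sign conjunct of the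
six-tuple in the conclusion is `HasAsaiSignCont … 1` (continued partial Asai `L`-function,
`Literature/NumberTheory/Automorphic/AsaiSignCont.lean`) instead of the raw Euler-product rendering
`HasAsaiSign … 1`.  The proof is the landed one verbatim: it only threads the six member properties through
`choose`/`obtain`, so the currency of the fifth conjunct is immaterial.  FACT-FREE, rc 0, 0 sorries.

Setting.  `F/F₀` quadratic over the totally real `F₀`, `π` cuspidal on `GL_n/F`, a prime `ℓ`,
`ι : ℚ̄_ℓ ≃ ℂ`, the twisting Artin avatar `eψ : Γ_F → GL_1(ℂ)`; `Guard π eψ v α c` and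
`hostPoly ι n α c v` are the crux's guard family and host polynomial at a place `v` of `F₀`.

Statement.  ASSUME (`hmember`, continuation form) that for every CM quadratic `K/F₀` ramified at some
guarded place of `F₀` and admitting no `F₀`-embedding of `F`, `MemberPkgCont F₀ π ι eψ K` holds (a level
structure `hK`, a cuspidal `τ'` on `GL_{2n}/K`, an infinity type `T`, a Hecke character `ψ₁` with:
`τ'` of infinity type `T`, `T` `C`-algebraic and weakly regular, `τ'` conjugate self-dual a.e. and of
standard Asai sign `HasAsaiSignCont (complexConj K) 1`, `ψ₁` algebraic, and the Satake → host-polynomial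
dictionary `MemberDict`).  THEN: a modulus `m ≠ 0` (here `1`) and a finite `B ⊆ ℕ` such that the members
`F₀(√-D)`, `D ∈ QuadraticFamily.GoodPrime F₀ m B`, carry such data member by member, with the six
properties (continuation-form sign), control almost everywhere on each member (with `ℓ ∉ u`), and
coverage of every guarded `v ∤ ℓ` by a member in which `v` splits at one place `u ∣ v` — the input of
`stub_patch` once `stub_galoisOverK_cont` has turned each member into a semisimple `ℓ`-adic
representation.

Proof.  Identical to the landed `stub_package_of_member`: `B` := the rational primes below the finitely
many places of `F₀` ramified over `ℚ` or not guarded-and-prime-to-`ℓ` (`eventually_guard`), together with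
the finitely many primes `D` with `-D` a square in `F` (`finite_setOf_prime_isSquare_neg`); for a good
prime `D` a place `v₀ ∣ D` of `F₀` is guarded, unramified over `ℤ`, so `v₀(D) = 1` and `v₀` ramifies in
`F₀(√-D)` (`not_isUnramifiedIn_sqrtNegField`); an `F₀`-embedding `F → F₀(√-D)` would make `-D` a square
in `F` (`isSquare_neg_of_algHom`); the member is CM (`GoodPrime.isCMField`); control a.e. adds `ℓ ∉ u`
(`natCast_not_mem_of_under_eq`); coverage by `GoodPrime.exists_split`.

References: C. M. Sorensen, *A patching lemma*, LMS LNS 457 (2020), §1 Example [Sorensen2020];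
M. Harris, R. Taylor, Ann. of Math. Stud. 151 (2001), proof of Thm. VII.1.9 [HarrisTaylorAMS2001];
C. P. Mok, Mem. AMS 235 (2015), Thm. 2.5.4 (the continuation-form Asai sign) [Mok2014].
-/

open scoped BigOperators Polynomial
open Filter Set Polynomial IsDedekindDomain NumberField
open Literature.NumberTheory.Automorphic Literature.NumberTheory.GaloisRepresentations
open Literature.NumberTheory.GaloisRepresentations.QuadraticFamily
open Literature.NumberTheory.Automorphic.PatchingFamily
open Summit.Langlands.Langlands.Theorems.HostInducedRep.GrsExplicitDescent

-- `Summit.Langlands.Langlands.…` (summit = sub-problem name, D-0017 layout) trips `dupNamespace`.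
set_option linter.dupNamespace false

noncomputable section

namespace Summit.Langlands.Langlands.Theorems.HostInducedRep.OneTransparentPane

/-- **The family assembly in the continuation-form currency (`stub_package_of_member_cont`).**
Crux data: `F/F₀` quadratic over the totally real `F₀`, `π` cuspidal on `GL_n/F`, `ℓ`, `ι`, the
twisting Artin avatar `eψ`.  HYPOTHESIS `hmember`: for every CM quadratic `K/F₀` ramified at some
guarded place of `F₀` and admitting no `F₀`-embedding of `F`, the member conclusion `MemberPkgCont`
(six properties with the standard Asai sign in the CONTINUATION form `HasAsaiSignCont (complexConj K) 1`,
and the dictionary `MemberDict`).  CONCLUSION: the `GoodPrime` family `F₀(√-D)`, `D ∈ GoodPrime F₀ 1 B`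
(`B` finite), with those data member by member (sign conjunct `HasAsaiSignCont … 1`), control almost
everywhere on each member and coverage of every guarded `v ∤ ℓ` by a member in which `v` splits.
Proof: verbatim the landed `stub_package_of_member` (the six properties are only threaded through).
[cite: Sorensen2020, §1 Example] [cite: HarrisTaylorAMS2001, proof of Thm. VII.1.9] -/
theorem stub_package_of_member_cont : ∀ (F₀ F : Type) [Field F₀] [NumberField F₀] [Field F] [NumberField F] [Algebra F₀ F], IsTotallyReal F₀ → Module.finrank F₀ F = 2 → ∀ (n : ℕ) (hcpt : isCompact_glFiniteIntegralLevel n F) (π : CuspidalAutomorphicRepData n F hcpt) (ℓ : ℕ) [Fact ℓ.Prime] (ι : PadicAlgCl ℓ ≃+* ℂ) (eψ : FramedGaloisRep F ℂ 1), (∀ (K : Type) [Field K] [NumberField K] [Algebra F₀ K] [IsCMField K], Module.finrank F₀ K = 2 → (∃ v₀ : HeightOneSpectrum (𝓞 F₀), ¬ Algebra.IsUnramifiedIn (𝓞 K) v₀.asIdeal ∧ ∃ (α : HeightOneSpectrum (𝓞 F) → Multiset ℂ) (c : HeightOneSpectrum (𝓞 F) → ℂ), Guard π eψ v₀ α c)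 → IsEmpty (F →ₐ[F₀] K) → MemberPkgCont F₀ π ι eψ K) →
    ∃ (m : ℕ) (B : Set ℕ), m ≠ 0 ∧ B.Finite ∧
    ∃ (hK : ∀ D : QuadraticFamily.GoodPrime F₀ m B,
        isCompact_glFiniteIntegralLevel (2 * n) (QuadraticFamily.sqrtNegField F₀ D.1))
      (τ' : ∀ D : QuadraticFamily.GoodPrime F₀ m B,
        CuspidalAutomorphicRepData (2 * n) (QuadraticFamily.sqrtNegField F₀ D.1) (hK D))
      (T : ∀ D : QuadraticFamily.GoodPrime F₀ m B,
        InfinityType (QuadraticFamily.sqrtNegField F₀ D.1) (2 * n))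
      (ψ₁ : ∀ D : QuadraticFamily.GoodPrime F₀ m B,
        HeckeCharacter (QuadraticFamily.sqrtNegField F₀ D.1)),
      (∀ (D : QuadraticFamily.GoodPrime F₀ m B) [IsCMField (QuadraticFamily.sqrtNegField F₀ D.1)],
          (τ' D).1.HasInfinityType (T D) ∧ (T D).IsCAlgebraic ∧ (T D).IsWeaklyRegular ∧
          (τ' D).1.IsConjSelfDualAE
            (NumberField.IsCMField.complexConj (QuadraticFamily.sqrtNegField F₀ D.1)) ∧
          (τ' D).1.HasAsaiSignCont
            (NumberField.IsCMField.complexConj (QuadraticFamily.sqrtNegField F₀ D.1)) 1 ∧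
          (ψ₁ D).IsAlgebraic) ∧
      (∀ D : QuadraticFamily.GoodPrime F₀ m B,
        ∀ᶠ u : HeightOneSpectrum (𝓞 (QuadraticFamily.sqrtNegField F₀ D.1)) in Filter.cofinite,
        ∀ (v : HeightOneSpectrum (𝓞 F₀)) (α : HeightOneSpectrum (𝓞 F) → Multiset ℂ)
          (c : HeightOneSpectrum (𝓞 F) → ℂ), u.under (𝓞 F₀) = v → ((ℓ : ℕ) : 𝓞 F₀) ∉ v.asIdeal →
        (∀ w : HeightOneSpectrum (𝓞 F), w.under (𝓞 F₀) = v → w.asIdeal.ramificationIdx (𝓞 F₀) = 1 ∧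
            π.1.HasSatakeParamAt w (α w) ∧ eψ.IsUnramifiedAt w ∧
            eψ.HasFrobCharpolyAt w (Polynomial.X - Polynomial.C (c w))) →
        ((ℓ : ℕ) : 𝓞 (QuadraticFamily.sqrtNegField F₀ D.1)) ∉ u.asIdeal ∧ (ψ₁ D).IsUnramifiedAt u ∧
        ∃ β : Multiset ℂ, (τ' D).1.HasSatakeParamAt u β ∧
          arithFrobPolyOfSatake ι u.residueCard (2 * n)
              (β.map (fun b ↦ b * ((ψ₁ D).valueAtUniformizer u)⁻¹)) =
            (((∏ᶠ w ∈ {w : HeightOneSpectrum (𝓞 F) | w.under (𝓞 F₀) = v},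
              Polynomial.expand (PadicAlgCl ℓ) (w.asIdeal.inertiaDeg (𝓞 F₀))
                (arithFrobPolyOfSatake ι w.residueCard n ((α w).map (fun a ↦ a * c w)))).roots.map
            (fun x ↦ Polynomial.X - Polynomial.C (x ^ u.asIdeal.inertiaDeg (𝓞 F₀)))).prod)) ∧
      (∀ (v : HeightOneSpectrum (𝓞 F₀)) (α : HeightOneSpectrum (𝓞 F) → Multiset ℂ)
          (c : HeightOneSpectrum (𝓞 F) → ℂ), ((ℓ : ℕ) : 𝓞 F₀) ∉ v.asIdeal →
        (∀ w : HeightOneSpectrum (𝓞 F), w.under (𝓞 F₀) = v → w.asIdeal.ramificationIdx (𝓞 F₀) = 1 ∧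
            π.1.HasSatakeParamAt w (α w) ∧ eψ.IsUnramifiedAt w ∧
            eψ.HasFrobCharpolyAt w (Polynomial.X - Polynomial.C (c w))) →
        ∃ D : QuadraticFamily.GoodPrime F₀ m B,
          (v.asIdeal.primesOver (𝓞 (QuadraticFamily.sqrtNegField F₀ D.1))).ncard = 2 ∧
          ∃ u : HeightOneSpectrum (𝓞 (QuadraticFamily.sqrtNegField F₀ D.1)), u.under (𝓞 F₀) = v ∧
            ((ℓ : ℕ) : 𝓞 (QuadraticFamily.sqrtNegField F₀ D.1)) ∉ u.asIdeal ∧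
            (ψ₁ D).IsUnramifiedAt u ∧
            ∃ β : Multiset ℂ, (τ' D).1.HasSatakeParamAt u β ∧
              arithFrobPolyOfSatake ι u.residueCard (2 * n)
                  (β.map (fun b ↦ b * ((ψ₁ D).valueAtUniformizer u)⁻¹)) =
                (∏ᶠ w ∈ {w : HeightOneSpectrum (𝓞 F) | w.under (𝓞 F₀) = v},
                  Polynomial.expand (PadicAlgCl ℓ) (w.asIdeal.inertiaDeg (𝓞 F₀))
                    (arithFrobPolyOfSatake ι w.residueCard n ((α w).map (fun a ↦ a * c w))))) := by
  intro F₀ F _ _ _ _ _ hTR hdeg n hcpt π ℓ _ ι eψ hmember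
  classical
  -- §1 the finite set `B` of bad primes
  have hguard := eventually_guard (F₀ := F₀) π eψ ℓ
  have hR : {v : HeightOneSpectrum (𝓞 F₀) | ¬ Algebra.IsUnramifiedAt ℤ v.asIdeal}.Finite := by
    -- adapted from Literature/NumberTheory/Automorphic/ReciprocityGLnExistenceProofs.lean
    refine (Ideal.finite_factors (differentIdeal_ne_bot (A := ℤ) (B := 𝓞 F₀))).subset
      fun v hv ↦ ?_
    simp only [Set.mem_setOf_eq] at hv ⊢
    by_contra hdvd
    exact hv ((not_dvd_differentIdeal_iff (A := ℤ)).mp hdvd)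
  have hG : {v : HeightOneSpectrum (𝓞 F₀) | ¬ (((ℓ : ℕ) : 𝓞 F₀) ∉ v.asIdeal ∧
      ∃ (α : HeightOneSpectrum (𝓞 F) → Multiset ℂ) (c : HeightOneSpectrum (𝓞 F) → ℂ),
        Guard π eψ v α c)}.Finite :=
    Filter.eventually_cofinite.mp hguard
  choose f hf using fun v : HeightOneSpectrum (𝓞 F₀) ↦ exists_natPrime_natCast_mem v
  set B : Set ℕ := f '' ({v | ¬ Algebra.IsUnramifiedAt ℤ v.asIdeal} ∪
      {v | ¬ (((ℓ : ℕ) : 𝓞 F₀) ∉ v.asIdeal ∧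
        ∃ (α : HeightOneSpectrum (𝓞 F) → Multiset ℂ) (c : HeightOneSpectrum (𝓞 F) → ℂ),
          Guard π eψ v α c)}) ∪ {D : ℕ | D.Prime ∧ IsSquare (-(D : F))} with hBdef
  have hBfin : B.Finite := ((hR.union hG).image f).union (finite_setOf_prime_isSquare_neg F)
  have hB1 : ∀ D : ℕ, D.Prime → D ∉ B → ∀ v : HeightOneSpectrum (𝓞 F₀),
      ((D : ℕ) : 𝓞 F₀) ∈ v.asIdeal → Algebra.IsUnramifiedAt ℤ v.asIdeal ∧
        (((ℓ : ℕ) : 𝓞 F₀) ∉ v.asIdeal ∧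
          ∃ (α : HeightOneSpectrum (𝓞 F) → Multiset ℂ) (c : HeightOneSpectrum (𝓞 F) → ℂ),
            Guard π eψ v α c) := by
    intro D hD hDB v hv
    have hfv : f v = D := natPrime_eq_of_natCast_mem (hf v).1 hD (hf v).2 hv
    by_contra h
    rw [not_and_or] at h
    refine hDB (Or.inl ⟨v, ?_, hfv⟩)
    rcases h with h | h
    · exact Or.inl h
    · exact Or.inr h
  have hB2 : ∀ D : ℕ, D.Prime → D ∉ B → ¬ IsSquare (-(D : F)) :=
    fun D hD hDB hsq ↦ hDB (Or.inr ⟨hD, hsq⟩)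
  -- §2 the member statement for every good prime
  have key : ∀ D : GoodPrime F₀ 1 B,
      ∃ (hK : isCompact_glFiniteIntegralLevel (2 * n) (sqrtNegField F₀ D.1))
        (τ' : CuspidalAutomorphicRepData (2 * n) (sqrtNegField F₀ D.1) hK)
        (T : InfinityType (sqrtNegField F₀ D.1) (2 * n)) (ψ₁ : HeckeCharacter (sqrtNegField F₀ D.1)),
        (∀ [IsCMField (sqrtNegField F₀ D.1)],
          τ'.1.HasInfinityType T ∧ T.IsCAlgebraic ∧ T.IsWeaklyRegular ∧
          τ'.1.IsConjSelfDualAE (NumberField.IsCMField.complexConj (sqrtNegField F₀ D.1)) ∧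
          τ'.1.HasAsaiSignCont (NumberField.IsCMField.complexConj (sqrtNegField F₀ D.1)) 1 ∧
          ψ₁.IsAlgebraic) ∧
        (∀ᶠ u : HeightOneSpectrum (𝓞 (sqrtNegField F₀ D.1)) in cofinite,
          ∀ (v : HeightOneSpectrum (𝓞 F₀)) (α : HeightOneSpectrum (𝓞 F) → Multiset ℂ)
            (c : HeightOneSpectrum (𝓞 F) → ℂ), u.under (𝓞 F₀) = v → Guard π eψ v α c →
            ψ₁.IsUnramifiedAt u ∧ ∃ β : Multiset ℂ, τ'.1.HasSatakeParamAt u β ∧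
              arithFrobPolyOfSatake ι u.residueCard (2 * n)
                  (β.map (fun b ↦ b * (ψ₁.valueAtUniformizer u)⁻¹)) =
                ((hostPoly ι n α c v).roots.map
                  (fun x ↦ X - C (x ^ u.asIdeal.inertiaDeg (𝓞 F₀)))).prod) ∧
        (∀ (v : HeightOneSpectrum (𝓞 F₀)) (α : HeightOneSpectrum (𝓞 F) → Multiset ℂ)
            (c : HeightOneSpectrum (𝓞 F) → ℂ), Guard π eψ v α c →
            (v.asIdeal.primesOver (𝓞 (sqrtNegField F₀ D.1))).ncard = 2 →
            ∃ u : HeightOneSpectrum (𝓞 (sqrtNegField F₀ D.1)), u.under (𝓞 F₀) = v ∧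
              ψ₁.IsUnramifiedAt u ∧ ∃ β : Multiset ℂ, τ'.1.HasSatakeParamAt u β ∧
                arithFrobPolyOfSatake ι u.residueCard (2 * n)
                    (β.map (fun b ↦ b * (ψ₁.valueAtUniformizer u)⁻¹)) = hostPoly ι n α c v) := by
    intro D
    haveI hCM : IsCMField (sqrtNegField F₀ D.1) := GoodPrime.isCMField (Or.inl hTR) D
    have hD : D.1.Prime := D.2.1
    have hDB : D.1 ∉ B := D.2.2.2.1
    obtain ⟨v₀, hv₀⟩ := exists_heightOneSpectrum_natCast_mem F₀ hD
    obtain ⟨hunrZ, -, α₀, c₀, hg₀⟩ := hB1 D.1 hD hDB v₀ hv₀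
    have hram : ¬ Algebra.IsUnramifiedIn (𝓞 (sqrtNegField F₀ D.1)) v₀.asIdeal :=
      not_isUnramifiedIn_sqrtNegField v₀ (intValuation_natCast_eq_of_isUnramifiedAt hD v₀ hv₀ hunrZ)
    have hempty : IsEmpty (F →ₐ[F₀] sqrtNegField F₀ D.1) :=
      ⟨fun φ ↦ hB2 D.1 hD hDB (isSquare_neg_of_algHom hdeg φ)⟩
    obtain ⟨hK, τ', T, ψ₁, h1, h2, h3, h4, h5, h6, h7, h8⟩ :=
      hmember (sqrtNegField F₀ D.1) finrank_sqrtNegField ⟨v₀, hram, α₀, c₀, hg₀⟩ hempty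
    exact ⟨hK, τ', T, ψ₁, ⟨h1, h2, h3, h4, h5, h6⟩, h7, h8⟩
  choose hK τ' T ψ₁ hsix hdict hcov using key
  refine ⟨1, B, one_ne_zero, hBfin, hK, τ', T, ψ₁, fun D ↦ hsix D, fun D ↦ ?_, ?_⟩
  · -- §3 control almost everywhere on the member `D`
    filter_upwards [hdict D] with u hu v α c huv hℓ hg
    obtain ⟨hψ, β, hβ, heq⟩ := hu v α c huv hg
    exact ⟨natCast_not_mem_of_under_eq huv hℓ, hψ, β, hβ, heq⟩
  · -- §4 coverage of every guarded `v` by a member in which `v` splits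
    intro v α c hℓ hg
    obtain ⟨D, hsplit⟩ := GoodPrime.exists_split F₀ 1 B one_ne_zero hBfin v
    rw [finrank_sqrtNegField] at hsplit
    obtain ⟨u, huv, hψ, β, hβ, heq⟩ := hcov D v α c hg hsplit
    exact ⟨D, hsplit, u, huv, natCast_not_mem_of_under_eq huv hℓ, hψ, β, hβ, heq⟩

end Summit.Langlands.Langlands.Theorems.HostInducedRep.OneTransparentPane

end
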